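import Literature.AlgebraicGeometry.Modules.HypercohomologyAffineSections
import Literature.AlgebraicGeometry.Modules.IsoOfAffineCover
import Literature.AlgebraicGeometry.Modules.HigherDirectImageRestrictOpen
import Literature.Algebra.Homology.RightDerivedFunctorPlusInjectiveModel
import Mathlib.AlgebraicGeometry.Modules.Tilde
import HarnessLib

/-!
# `(Γ(Spec R, I•))~ → I•` is a quasi-isomorphism for a bounded-below injective complex with quasi-coherent
# cohomology; every `E ∈ D⁺_qc(Mod 𝒪_{Spec R})` is the class of a complex of quasi-coherent modules
# (Görtz–Wedhorn II, Lemma 22.36; Hartshorne, *Residues and Duality*, II Cor. 7.19 — affine case)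

Görtz–Wedhorn II Lemma 22.36: for `X = Spec R` the functor `ι_X : D(R) = D(QCoh X) → D_qcoh(X)` is an
equivalence with quasi-inverse `RΓ(X, –)`; the counit `R(Γ(X, E))~ → E` is an isomorphism, because on `Hʲ` it is
`(Γ(X, Hʲ(E)))~ = Hʲ(E)` (Cor. 21.46 + Thm. 22.2: `RʲΓ(X, E) = Γ(X, Hʲ(E))`, the tree's
`Modules/HypercohomologyAffineSections`). This file proves the BOUNDED-BELOW case in the shape the tree's Stage-I
consumer `Modules/BoundedCoherentVBModelsOfRepresentative.exists_vbModel_of_qcRepresentative_of_isLE` wants: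

* §1 **a quasi-isomorphism criterion** (`quasiIso_of_app_bijective_of_cover`, `quasiIso_of_app_top_bijective`):
  a chain map `ε : M• → K•` of cochain complexes of `𝒪_X`-modules, from a complex `M•` with affine-localizing
  TERMS to a bounded-below complex `K•` with `Γ`-acyclic terms (on affine opens; e.g. injective) and
  affine-localizing COHOMOLOGY SHEAVES, which is bijective on the sections over the members of an affine open
  cover, is a quasi-isomorphism — on each affine `V`, `Γ(V, 𝓗ʲ(M)) = Hʲ(Γ(V, M•))`
  (`Modules/HomologySheafSections` §3) and `Γ(V, 𝓗ʲ(K)) = Hʲ(Γ(V, K•))` (`Modules/HypercohomologyAffineSections` §3),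
  so `𝓗ʲ(ε)` is bijective on `Γ(V, –)` (`homologyMap_app_bijective`), and `𝓗ʲ(M)`, `𝓗ʲ(K)` are affine-localizing
  (`Modules/IsoOfAffineCover.isIso_of_app_bijective_of_cover`);
* §2 **on `Spec R`**: the counit `N.fromTildeΓ : (Γ(Spec R, N))~ → N` of Mathlib's adjunction `tilde.adjunction`
  is bijective on global sections (`fromTildeΓ_app_top_bijective`, the triangle identity), hence
  **`exists_quasiIso_from_qc_of_injective`**: every bounded-below complex `I•` of injective `𝒪_{Spec R}`-modules
  with affine-localizing cohomology sheaves receives a quasi-isomorphism `ε : M• → I•` from a complex of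
  QUASI-COHERENT modules (`M• = (Γ(Spec R, I•))~` termwise, `ε` the counit), bijective on global sections, `M•`
  with the same bound; and **`exists_qcRepresentative_Spec`**: every `E : DerivedCategory.Plus (Spec R).Modules`
  with `E.IsGE a` and affine-localizing cohomology sheaves is `DerivedCategory.Plus.Q.obj ⟨M, a, _⟩` for a complex
  `M` of quasi-coherent (affine-localizing) modules — Stage I of the `D⁺_qc` comparison ON AFFINE SCHEMES
  (injective model by Mathlib's CM5a factorisation `CochainComplex.Plus.modelCategoryQuillen.exists_quasiIso_injective`).

Everything is PROVED; 0 named facts; no definitions, no instances (the right-adjoint structure of Mathlib's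
global-sections functor `moduleSpecΓFunctor` is bound locally inside the proofs). Not here: the globalisation to a
separated scheme with a finite affine cover (Čech bicomplex of the models on the affine pieces), i.e. Stage I for
abelian varieties. Typed for the cell `pub-hodge-ring2` — a research route conditional on HC_CM, not a corollary;
nothing in this file refers to it.

## References

* U. Görtz, T. Wedhorn, *Algebraic Geometry II: Cohomology of Schemes*, Springer Spektrum (2023): Lemma 22.36 and
  its proof (pp. 349–350), Thm. 22.35, Cor. 21.46 (p. 245), Thm. 22.2 (p. 328). [GortzWedhorn2023]
* R. Hartshorne, *Residues and Duality*, LNM 20 (1966), II Cor. 7.19 (p. 133). [HartshorneRD1966]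
* R. Hartshorne, *Algebraic Geometry*, GTM 52 (1977), II Cor. 5.5 (p. 113), III Prop. 8.5 (p. 251). [Hartshorne1977]
* The Stacks Project, Tags 01XB, 06Z0. [StacksProject]
-/

noncomputable section

-- `TopCat.Presheaf`/`Scheme.Modules` are not reducible (as in Mathlib's `AlgebraicGeometry/Modules/Sheaf.lean`).
set_option backward.isDefEq.respectTransparency false

open CategoryTheory CategoryTheory.Limits AlgebraicGeometry TopologicalSpace Opposite HomologicalComplex

universe w u

namespace Literature.AlgebraicGeometry.Modules

open Literature.AlgebraicGeometry.Morphisms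

/-! ## §1 A quasi-isomorphism criterion: bijective on the sections over an affine cover -/

section Criterion

variable {X : Scheme.{u}} {M K : CochainComplex X.Modules ℤ} (ε : M ⟶ K)

/-- Chain maps commute with the differentials on sections. [cite: Hartshorne1977, III §1 p. 203 (morphisms of complexes)] -/
theorem f_app_d_app (i j : ℤ) (V : X.Opens) (x : Γ(M.X i, V)) :
    (ε.f j).app V ((M.d i j).app V x) = (K.d i j).app V ((ε.f i).app V x) := by
  change (M.d i j ≫ ε.f j).app V x = (ε.f i ≫ K.d i j).app V x
  rw [ε.comm i j]

/-- `Zʲ(ε)` followed by `Zʲ(K) ↪ Kʲ` is `Zʲ(M) ↪ Mʲ` followed by `εʲ`, on sections.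
[cite: Hartshorne1977, III §1 p. 203 (morphisms of complexes)] -/
theorem iCycles_app_cyclesMap_app (j : ℤ) (V : X.Opens) (z : Γ(M.cycles j, V)) :
    (K.iCycles j).app V ((cyclesMap ε j).app V z) = (ε.f j).app V ((M.iCycles j).app V z) := by
  change (cyclesMap ε j ≫ K.iCycles j).app V z = (M.iCycles j ≫ ε.f j).app V z
  rw [cyclesMap_i]

/-- `𝓗ʲ(ε) ∘ π_M = π_K ∘ Zʲ(ε)` on sections. [cite: Hartshorne1977, III §1 p. 203 (morphisms of complexes)] -/
theorem homologyMap_app_homologyπ_app (j : ℤ) (V : X.Opens) (z : Γ(M.cycles j, V)) :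
    (homologyMap ε j).app V ((M.homologyπ j).app V z) = (K.homologyπ j).app V ((cyclesMap ε j).app V z) := by
  change (M.homologyπ j ≫ homologyMap ε j).app V z = (cyclesMap ε j ≫ K.homologyπ j).app V z
  rw [homologyπ_naturality]

variable {ε}

/-- **`Γ(V, 𝓗ʲ(ε))` is bijective on an affine open `V` over which `ε` is bijective on sections**, for `ε : M• → K•`
from a complex with affine-localizing terms to a bounded-below `Γ`-acyclic complex with affine-localizing cohomology
sheaves: both `Γ(V, 𝓗ʲ(M))` and `Γ(V, 𝓗ʲ(K))` are `Hʲ` of the sections (`Modules/HomologySheafSections` §3,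
`Modules/HypercohomologyAffineSections` §3), and `Γ(V, ε•)` is an isomorphism of complexes.
[cite: GortzWedhorn2023, proof of Lemma 22.36 (p. 350)] [cite: Hartshorne1977, III Prop. 8.5 (p. 251)] -/
theorem homologyMap_app_bijective (hM : ∀ i, IsAffineLocalizing (M.X i))
    (hK : ∀ (i : ℤ) ⦃V : X.Opens⦄, IsAffineOpen V → IsAcyclicOn (K.X i) V)
    (hH : ∀ i, IsAffineLocalizing (K.homology i)) (a : ℤ) [K.IsStrictlyGE a]
    {V : X.Opens} (hV : IsAffineOpen V) (hε : ∀ i, Function.Bijective ((ε.f i).app V)) (j : ℤ) :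
    Function.Bijective ((homologyMap ε j).app V) := by
  constructor
  · -- injective: a class `π_M z'` killed by `𝓗ʲ(ε)` has `Zʲ(ε) z' = toCycles v`, `v = ε v'`, and `z' = toCycles v'`
    rw [injective_iff_map_eq_zero]
    intro w hw
    obtain ⟨z', rfl⟩ := homologyπ_app_surjective hM j hV w
    rw [homologyMap_app_homologyπ_app] at hw
    obtain ⟨v, hv⟩ := (homologyπ_app_eq_zero_iff_of_isAcyclicOn_X hK hH a j hV _).1 hw
    obtain ⟨v', rfl⟩ := (hε (j - 1)).2 v
    have hz' : (M.toCycles (j - 1) j).app V v' = z' := by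
      apply iCycles_app_injective M j V
      apply (hε j).1
      rw [iCycles_app_toCycles_app, f_app_d_app, ← iCycles_app_toCycles_app K (j - 1) j, hv,
        iCycles_app_cyclesMap_app]
    rw [← hz', homologyπ_app_toCycles_app]
  · -- surjective: a class `π_K z` has `iCycles z = ε x'` with `d x' = 0`, so `x' = iCycles z'` and `Zʲ(ε) z' = z`
    intro y
    obtain ⟨z, rfl⟩ := homologyπ_app_surjective_of_isAcyclicOn_X hK hH a j hV y
    obtain ⟨x', hx'⟩ := (hε j).2 ((K.iCycles j).app V z)
    have hd : (M.d j (j + 1)).app V x' = 0 := by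
      apply (hε (j + 1)).1
      rw [f_app_d_app, hx', d_app_iCycles_app, map_zero]
    obtain ⟨z', hz'⟩ := exists_iCycles_app_eq M j (j + 1) (by simp) V x' hd
    refine ⟨(M.homologyπ j).app V z', ?_⟩
    rw [homologyMap_app_homologyπ_app]
    congr 1
    apply iCycles_app_injective K j V
    rw [iCycles_app_cyclesMap_app, hz', hx']

/-- **Quasi-isomorphism criterion.** Let `ε : M• → K•` be a chain map of cochain complexes of `𝒪_X`-modules,
`M•` with affine-localizing (e.g. quasi-coherent) terms, `K•` bounded below with `Γ`-acyclic terms on affine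
opens (e.g. injective) and affine-localizing cohomology sheaves. If `ε` is bijective on the sections over the
members of an affine open cover of `X`, then `ε` is a quasi-isomorphism (`𝓗ʲ(M)`, `𝓗ʲ(K)` are affine-localizing
and `𝓗ʲ(ε)` is bijective on the cover, `Modules/IsoOfAffineCover`). [cite: GortzWedhorn2023, Lemma 22.36 (p. 349)]
[cite: Hartshorne1977, II Cor. 5.5 (p. 113) and III Prop. 8.5 (p. 251)] -/
theorem quasiIso_of_app_bijective_of_cover (hM : ∀ i, IsAffineLocalizing (M.X i))
    (hK : ∀ (i : ℤ) ⦃V : X.Opens⦄, IsAffineOpen V → IsAcyclicOn (K.X i) V)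
    (hH : ∀ i, IsAffineLocalizing (K.homology i)) (a : ℤ) [K.IsStrictlyGE a]
    {ι' : Type*} (V : ι' → X.Opens) (hV : ∀ l, IsAffineOpen (V l)) (hcov : ⨆ l, V l = ⊤)
    (hε : ∀ l i, Function.Bijective ((ε.f i).app (V l))) : QuasiIso ε := by
  rw [quasiIso_iff]
  intro j
  rw [quasiIsoAt_iff_isIso_homologyMap]
  exact isIso_of_app_bijective_of_cover (homologyMap ε j) (isAffineLocalizing_homology M hM j) (hH j) V hV hcov
    fun l => homologyMap_app_bijective hM hK hH a (hV l) (hε l) j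

/-- **Quasi-isomorphism criterion on an affine scheme**: `ε : M• → K•` as in
`quasiIso_of_app_bijective_of_cover`, bijective on GLOBAL sections, is a quasi-isomorphism.
[cite: GortzWedhorn2023, Lemma 22.36 (p. 349)] [cite: Hartshorne1977, II Cor. 5.5 (p. 113)] -/
theorem quasiIso_of_app_top_bijective [IsAffine X] (hM : ∀ i, IsAffineLocalizing (M.X i))
    (hK : ∀ (i : ℤ) ⦃V : X.Opens⦄, IsAffineOpen V → IsAcyclicOn (K.X i) V)
    (hH : ∀ i, IsAffineLocalizing (K.homology i)) (a : ℤ) [K.IsStrictlyGE a]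
    (hε : ∀ i, Function.Bijective ((ε.f i).app ⊤)) : QuasiIso ε :=
  quasiIso_of_app_bijective_of_cover hM hK hH a (fun _ : Unit => (⊤ : X.Opens)) (fun _ => isAffineOpen_top X)
    (by simp) (fun _ i => hε i)

end Criterion

/-! ## §2 On `Spec R`: the counit `(Γ(Spec R, N))~ → N`, the quasi-coherent model of an injective complex,
and the representative of an object of `D⁺_qc` -/

section SpecCase

variable {R : CommRingCat.{u}}

/-- **The counit `(Γ(Spec R, N))~ → N` is bijective on global sections** (triangle identity of Mathlib's
`tilde.adjunction`: `Γ(N) → Γ((Γ N)~) → Γ(N)` is the identity and the first map is an isomorphism).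
[cite: GortzWedhorn2023, proof of Lemma 22.36 (p. 350)] [cite: Hartshorne1977, II Cor. 5.5 (p. 113)] -/
theorem fromTildeΓ_app_top_bijective (N : (Spec (.of R)).Modules) :
    Function.Bijective (N.fromTildeΓ.app ⊤) := by
  have h := Scheme.Modules.toOpen_fromTildeΓ_app N ⊤
  have hid : (modulesSpecToSheaf.obj N).1.map (homOfLE (le_top : (⊤ : (Spec (.of R)).Opens) ≤ ⊤)).op = 𝟙 _ := by
    rw [show homOfLE (le_top : (⊤ : (Spec (.of R)).Opens) ≤ ⊤) = 𝟙 _ from Subsingleton.elim _ _, op_id,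
      CategoryTheory.Functor.map_id]
  rw [hid] at h
  haveI : IsIso ((modulesSpecToSheaf.map N.fromTildeΓ).1.app (op ⊤)) := IsIso.of_isIso_fac_left h
  exact ConcreteCategory.bijective_of_isIso ((modulesSpecToSheaf.map N.fromTildeΓ).1.app (op ⊤))

/-- **The quasi-coherent model of a bounded-below `Γ`-acyclic complex with quasi-coherent cohomology on `Spec R`**
(Görtz–Wedhorn II Lemma 22.36, first adjunction isomorphism, bounded-below case): for a bounded-below complex `I•`
of `𝒪_{Spec R}`-modules with `Γ`-acyclic terms on affine opens (e.g. injective) and affine-localizing cohomology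
sheaves there is a QUASI-ISOMORPHISM `ε : M• → I•` from a complex `M•` of QUASI-COHERENT modules with the same bound,
bijective on global sections — namely `M• = (Γ(Spec R, I•))~` termwise and `ε` the counit of `tilde.adjunction`.
[cite: GortzWedhorn2023, Lemma 22.36 (pp. 349–350)] [cite: HartshorneRD1966, II Cor. 7.19 (p. 133)] -/
theorem exists_quasiIso_from_qc_of_isAcyclicOn (I : CochainComplex (Spec (.of R)).Modules ℤ)
    (hI : ∀ (i : ℤ) ⦃V : (Spec (.of R)).Opens⦄, IsAffineOpen V → IsAcyclicOn (I.X i) V)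
    (hH : ∀ i, IsAffineLocalizing (I.homology i)) (a : ℤ) [I.IsStrictlyGE a] :
    ∃ (M : CochainComplex (Spec (.of R)).Modules ℤ) (ε : M ⟶ I), QuasiIso ε ∧ M.IsStrictlyGE a ∧
      (∀ i, (M.X i).IsQuasicoherent) ∧ (∀ i, IsAffineLocalizing (M.X i)) ∧
      ∀ i, Function.Bijective ((ε.f i).app ⊤) := by
  -- the global-sections functor is a right adjoint (Mathlib `tilde.adjunction`), hence preserves zero morphisms
  haveI : (moduleSpecΓFunctor (R := R)).IsRightAdjoint := tilde.adjunction.isRightAdjoint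
  let G : (Spec (.of R)).Modules ⥤ (Spec (.of R)).Modules := moduleSpecΓFunctor (R := R) ⋙ tilde.functor R
  let M : CochainComplex (Spec (.of R)).Modules ℤ := (G.mapHomologicalComplex (ComplexShape.up ℤ)).obj I
  let ε : M ⟶ I :=
    { f := fun i => (I.X i).fromTildeΓ
      comm' := fun i j _ => by
        have h := Scheme.Modules.fromTildeΓNatTrans.naturality (I.d i j)
        simp only [Functor.id_map] at h
        exact h.symm }
  have hMqc : ∀ i, (M.X i).IsQuasicoherent := fun i =>
    inferInstanceAs (AlgebraicGeometry.tilde ((moduleSpecΓFunctor (R := R)).obj (I.X i))).IsQuasicoherent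
  have hM : ∀ i, IsAffineLocalizing (M.X i) := fun i => by
    haveI := hMqc i
    exact IsAffineLocalizing.of_isQuasicoherent (M.X i)
  haveI hMa : M.IsStrictlyGE a := by
    rw [CochainComplex.isStrictlyGE_iff]
    intro i hi
    exact Functor.map_isZero G (I.isZero_of_isStrictlyGE a i hi)
  have hε : ∀ i, Function.Bijective ((ε.f i).app ⊤) := fun i => fromTildeΓ_app_top_bijective (I.X i)
  exact ⟨M, ε, quasiIso_of_app_top_bijective hM hI hH a hε, hMa, hMqc, hM, hε⟩

/-- The injective case of `exists_quasiIso_from_qc_of_isAcyclicOn` (injective modules are flasque, hence acyclic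
on every open, Hartshorne III.2.4–2.5). [cite: GortzWedhorn2023, Lemma 22.36 (pp. 349–350)] [cite: Hartshorne1977, III Prop. 2.5] -/
theorem exists_quasiIso_from_qc_of_injective (I : CochainComplex (Spec (.of R)).Modules ℤ)
    [∀ i, Injective (I.X i)] (hH : ∀ i, IsAffineLocalizing (I.homology i)) (a : ℤ) [I.IsStrictlyGE a] :
    ∃ (M : CochainComplex (Spec (.of R)).Modules ℤ) (ε : M ⟶ I), QuasiIso ε ∧ M.IsStrictlyGE a ∧
      (∀ i, (M.X i).IsQuasicoherent) ∧ (∀ i, IsAffineLocalizing (M.X i)) ∧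
      ∀ i, Function.Bijective ((ε.f i).app ⊤) :=
  exists_quasiIso_from_qc_of_isAcyclicOn I (fun i V _ => IsAcyclicOn.of_injective (I.X i) V) hH a

/-- **Stage I of the `D⁺_qc` comparison on an affine scheme (Görtz–Wedhorn II Lemma 22.36 ∕ Hartshorne RD II 7.19,
bounded below): every object `E` of `D⁺(Mod 𝒪_{Spec R})` with `E.IsGE a` whose cohomology sheaves are
affine-localizing (quasi-coherent) is the class `Q⁺⟨M, a, _⟩` of a bounded-below complex `M` of QUASI-COHERENT
modules** — in the shape consumed by `Modules/BoundedCoherentVBModelsOfRepresentative.exists_vbModel_of_qcRepresentative_of_isLE`.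
Proof: a bounded-below injective model `I•` of `E` (Mathlib CM5a), its quasi-coherent model
`(Γ(Spec R, I•))~ ⥲ I•` (`exists_quasiIso_from_qc_of_injective`), and `Q⁺` inverts quasi-isomorphisms.
[cite: GortzWedhorn2023, Lemma 22.36 (pp. 349–350)] [cite: HartshorneRD1966, II Cor. 7.19 (p. 133)] -/
theorem exists_qcRepresentative_Spec [HasDerivedCategory.{w} (Spec (.of R)).Modules]
    (E : DerivedCategory.Plus (Spec (.of R)).Modules) (a : ℤ) [E.IsGE a]
    (hqc : ∀ k : ℤ, IsAffineLocalizing ((DerivedCategory.Plus.homologyFunctor _ k).obj E)) :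
    ∃ (M : CochainComplex (Spec (.of R)).Modules ℤ) (hn : M.IsStrictlyGE a),
      (∀ i, (M.X i).IsQuasicoherent) ∧ (∀ i, IsAffineLocalizing (M.X i)) ∧
      Nonempty (DerivedCategory.Plus.Q.obj ⟨M, a, hn⟩ ≅ E) := by
  -- a bounded-below representative of `E`, then an injective model
  obtain ⟨K₀, hK₀, ⟨e₀⟩⟩ := (DerivedCategory.Plus.ι.obj E).exists_iso_Q_obj_of_isGE a
  obtain ⟨I, ι, hι, hIinj, hIa⟩ := CochainComplex.Plus.modelCategoryQuillen.exists_quasiIso_injective K₀ a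
  haveI := hι
  haveI := hIinj
  haveI := hIa
  -- `E ≅ Q⁺ K₀ ≅ Q⁺ I`
  let eK₀ : DerivedCategory.Plus.Q.obj ⟨K₀, a, hK₀⟩ ≅ E :=
    (DerivedCategory.TStructure.t (C := (Spec (.of R)).Modules)).plus.fullyFaithfulι.preimageIso
      (ιQObjIso (⟨K₀, a, hK₀⟩ : CochainComplex.Plus _) ≪≫ e₀.symm)
  let ι' : (⟨K₀, a, hK₀⟩ : CochainComplex.Plus (Spec (.of R)).Modules) ⟶ ⟨I, a, hIa⟩ := ObjectProperty.homMk ι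
  haveI : QuasiIso ι'.hom := hι
  haveI := Functor.isIso_Q_map_of_quasiIso (C := (Spec (.of R)).Modules) ι'
  let eI : DerivedCategory.Plus.Q.obj ⟨I, a, hIa⟩ ≅ E := (asIso (DerivedCategory.Plus.Q.map ι')).symm ≪≫ eK₀
  -- the cohomology sheaves of `I` are those of `E`: affine-localizing
  have hH : ∀ i, IsAffineLocalizing (I.homology i) := fun i =>
    IsAffineLocalizing.of_iso ((DerivedCategory.Plus.homologyFunctor _ i).mapIso eI.symm ≪≫
      plusHomologyFunctorQObjIso ⟨I, a, hIa⟩ i) (hqc i)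
  -- the quasi-coherent model of `I`
  obtain ⟨M, ε, hε, hMa, hMqc, hM, -⟩ := exists_quasiIso_from_qc_of_injective I hH a
  haveI := hε
  let ε' : (⟨M, a, hMa⟩ : CochainComplex.Plus (Spec (.of R)).Modules) ⟶ ⟨I, a, hIa⟩ := ObjectProperty.homMk ε
  haveI : QuasiIso ε'.hom := hε
  haveI := Functor.isIso_Q_map_of_quasiIso (C := (Spec (.of R)).Modules) ε'
  exact ⟨M, hMa, hMqc, hM, ⟨asIso (DerivedCategory.Plus.Q.map ε') ≪≫ eI⟩⟩

end SpecCase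

end Literature.AlgebraicGeometry.Modules

end
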